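import Summits.ResolutionOfSingularities.ResolutionOfSingularities.Theorems.HomologicalConductorNoZenoThreadDichotomyPrep
import Literature.AlgebraicGeometry.Resolution.ArithmeticalThreefolds
import Summits.ResolutionOfSingularities.ResolutionOfSingularities.Theorems.FrobeniusClosingSteerLowTowerResidueTrdeg
import HarnessLib

/-!
# Route `HomologicalConductor`, crux `NoZenoR` (stmt-ResolutionOfSingularities-19943; aside twin `NoZeno` 16483):
# (TD) THE THREAD DICHOTOMY — the union of the thread germs is a valuation ring, or a prime divisor dominates the thread

`[OURS · L W4.4]` Cell res-hironaka, crux chain W4.4; planner res-L0-w44-plan-1's entry cut of the (v28) stub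
`stub_HabExSw0` (CHAIN v19 §3.8, `Beta2Descent-r3_3.lean` §8 `Sig.ThreadDichotomy`), executed by res-L0-w44-stub-3; file 2/2
(preparations in `…NoZenoThreadDichotomyPrep`).  Nothing here is a statement of the manuscript under review (Hironaka 2017);
AI-written, weaker than expert review.

* `threadDichotomy` — **(TD)**, with the binders of the planner's `Sig.ThreadDichotomy`: along an infinite singular prime
  thread in transcendence degree `3` past its escape stage, with germs `D_(n+1) = (T_(n+1))_(P_(n+1))`
  (`Parasite.locPrime`; the planner's `Beta2Descent.germ O A P hP n`) and `D_∞ := ⋃ D_(n+1)`: EITHER `D_∞` is a valuation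
  ring `W` of `K` (dominating every germ, equal to their union, containing the residually transcendental escape element,
  NOT essentially of finite type over `k`), OR some valuation ring `V ⊇ k` of `K` which is a DISCRETE VALUATION RING with
  two algebraically independent residues (a prime divisor of `K/k`) dominates every germ.  CASE A is the union of the
  dominated chain (`subringDominates_locPrime_tower_of_le`, `not_essFiniteType_of_dominated_union`, T-GERM); CASE B is
  Abhyankar's Lemma 7 (`DominatedUnions.exists_valuationSubring_dominates_of_chain'`) + the escape unit
  (`aeval_escape_mem_not_mem`) + `valuation_mvPolynomial_aeval_eq_one` + Zariski–Samuel VI §14 Thm 31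
  (`isDiscreteValuationRing_of_primeDivisor`, `3 ≤ 2 + 1`); `V ≠ K` because a germ dominated by `K` is a field while
  `D_(mₑ+1)` is singular.

* `germResidueDep` — **(GRD)** (strategist res-L0-w44-strat-1's `Sig.GermResidueDep`, binder for binder; proof ported
  from its HOME file `line-ndt-grd-r1.lean`): past the escape stage any two elements of a thread germ are residually
  DEPENDENT over `k` — some non-zero `f ∈ k[X₀,X₁]` has `f(z₀,z₁)` zero or a non-unit of the germ; by the dimension
  formula `tr.deg_k κ(P_(n+1)) + ht P_(n+1) = tr.deg_k K = 3` (`SwitchingDichotomy.LowTower.exists_trdeg_residueField_add_height_eq`)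
  with `ht P_(n+1) = dim D_(n+1) = 2` (T-GERM), so `tr.deg_k κ = 1 < 2`.  It is the proved half of the strategist's cut
  `(NDT) ⟸ (GRD) ∧ (NDT-BP)` of the remaining entry-cut piece (NDT).

With (UE) `exists_isSandwichedGerm_of_union` (`…NoZenoUnionEntry`) this leaves, of the planner's entry cut
`stub_HabExSw0 ⟸ (TD) ∧ (LU₂W) ∧ (UE) ∧ (NDT)`, only (LU₂W) (res-L0-w44-stub-1, modulo CJS) and (NDT) (the content).

References: S. S. Abhyankar, Amer. J. Math. 78 (1956), Lemma 7 [`Abhyankar1956Valuations`];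
O. Zariski, P. Samuel, *Commutative Algebra* II, Ch. VI §14, Thm. 31 [`ZariskiSamuel1960`] (both tree theorems).
-/

-- single-problem summit: the doubled namespace component `ResolutionOfSingularities` is forced
set_option linter.dupNamespace false

noncomputable section

open IsLocalRing Polynomial
open Literature.AlgebraicGeometry.Resolution

namespace Summit.ResolutionOfSingularities.ResolutionOfSingularities.Theorems.NoZeno.Sandwiched

open Summit.ResolutionOfSingularities.ResolutionOfSingularities.Theses.HomologicalConductor
open Summit.ResolutionOfSingularities.ResolutionOfSingularities.Theorems.NoZeno.Birth
open Summit.ResolutionOfSingularities.ResolutionOfSingularities.Theorems.NoZeno.SandwichCluster.Parasite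
  (locPrime mem_locPrime_iff mem_locPrime_of_mem inv_mem_locPrime_of_not_mem ne_zero_of_not_mem_ideal)
open Summit.ResolutionOfSingularities.ResolutionOfSingularities.Theorems.NoZeno.SandwichCluster

variable {k K : Type} [Field k] [Field K] [Algebra k K]

/-! ## (TD) The thread dichotomy -/

section Main

/-- **(TD) THE THREAD DICHOTOMY** — the planner's `Sig.ThreadDichotomy` (r3.3 `Beta2Descent-r3_3.lean` §8) binder
for binder.  For an infinite singular prime thread in transcendence degree `3` past its escape stage `mₑ` (germs
`D_(n+1) = (T_(n+1))_(P_(n+1))`, the planner's `germ O A P hP n`), let `D_∞ := ⋃ D_(n+1)`.  EITHER `D_∞` is a valuation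
ring `W` of `K` — it dominates every germ, is their union, contains the escape element `s` whose residue is
transcendental over `k`, and is NOT essentially of finite type over `k` (`not_essFiniteType_of_dominated_union`: the
germs past `mₑ` are singular by T-GERM) — OR some `t` has `t, t⁻¹ ∉ D_∞` and Abhyankar's Lemma 7
(`DominatedUnions.exists_valuationSubring_dominates_of_chain'`, on the dominated chain of local germs integrally closed
in `K`) yields a valuation ring `V ∋ t` containing `k` and dominating every germ, with two algebraically independent
residues `(t̄, s̄)` (`valuation_mvPolynomial_aeval_eq_one`); then `V ≠ K` (a germ dominated by `K` would be a field, but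
`D_(mₑ+1)` is singular) and `V` is a PRIME DIVISOR of `K/k`, hence a discrete valuation ring
(`isDiscreteValuationRing_of_primeDivisor`, Zariski–Samuel VI §14 Thm 31, tr.deg `3 ≤ 2 + 1`). [this work] -/
theorem threadDichotomy (O : ValuationSubring K) (A : Subalgebra k K)
    (hk : ∀ c : k, algebraMap k K c ∈ O) (hA : A.FG) (hfr : IsFractionRing ↥A K)
    (hAO : A.toSubring ≤ O.toSubring) (htr : Algebra.trdeg k K = 3)
    (P : ∀ m : ℕ, Ideal ↥(tower O A m)) (hP : ∀ m, (P m).IsPrime)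
    (hcompat : ∀ (m : ℕ) (x : K) (hx : x ∈ tower O A m) (hx' : x ∈ tower O A (m + 1)),
      (⟨x, hx'⟩ : ↥(tower O A (m + 1))) ∈ P (m + 1) ↔ (⟨x, hx⟩ : ↥(tower O A m)) ∈ P m)
    (hca : ∀ (m : ℕ) (x : K) (hx : x ∈ tower O A m),
      x ∈ ca (tower O A m) → (⟨x, hx⟩ : ↥(tower O A m)) ∈ P m)
    (mₑ : ℕ) (s : K) (hsT : s ∈ tower O A mₑ) (hvs : O.valuation s < 1)
    (hsP : (⟨s, hsT⟩ : ↥(tower O A mₑ)) ∉ P mₑ) :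
    (∃ W : ValuationSubring K,
        (∀ n : ℕ, SubringDominates (locPrime (tower O A (n + 1)) (P (n + 1)) (hP (n + 1))) W.toSubring) ∧
        (∀ x : K, x ∈ W → ∃ n : ℕ, x ∈ locPrime (tower O A (n + 1)) (P (n + 1)) (hP (n + 1))) ∧
        (∃ w : K, w ∈ W ∧ ∀ f : Polynomial k, f ≠ 0 → W.valuation (Polynomial.aeval w f) = 1) ∧
        ¬ (∃ B : Subalgebra k K, B.toSubring = W.toSubring ∧ Algebra.EssFiniteType k ↥B)) ∨
    (∃ V : ValuationSubring K, (∀ c : k, algebraMap k K c ∈ V) ∧ IsDiscreteValuationRing ↥V ∧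
        (∃ y : Fin 2 → K, (∀ i, y i ∈ V) ∧
          ∀ f : MvPolynomial (Fin 2) k, f ≠ 0 → V.valuation (MvPolynomial.aeval y f) = 1) ∧
        ∀ n : ℕ, SubringDominates (locPrime (tower O A (n + 1)) (P (n + 1)) (hP (n + 1))) V.toSubring) := by
  classical
  haveI := hfr
  set D : ℕ → Subring K := fun n => locPrime (tower O A (n + 1)) (P (n + 1)) (hP (n + 1)) with hD
  -- the escape element at the later stages
  have hsn : ∀ n : ℕ, mₑ ≤ n + 1 → s ∈ tower O A (n + 1) := fun n h => d2rc_mem_tower_of_le O A h hsT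
  have hsPn : ∀ (n : ℕ) (h : mₑ ≤ n + 1), (⟨s, hsn n h⟩ : ↥(tower O A (n + 1))) ∉ P (n + 1) :=
    fun n h => Thread.not_mem_thread_of_le O A P hcompat hsT hsP h (hsn n h)
  have hsD : ∀ n : ℕ, mₑ ≤ n + 1 → s ∈ D n := fun n h => mem_locPrime_of_mem _ _ _ (hsn n h)
  -- T-GERM: past the escape stage the germs are singular
  have hsing : ∀ n : ℕ, mₑ ≤ n → ¬ IsRegularLocalRing ↥(D n) := by
    intro n hn
    haveI := hP (n + 1)
    exact (Thread.threadGerm_of_trdeg O A hk hA hfr hAO htr n (P (n + 1)) (hP (n + 1)) (hca (n + 1))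
      ⟨s, hsn n (by omega), hvs, hsPn n (by omega)⟩).2.2.1
  -- the `k`-algebra structure on a germ and the escape UNIT
  have hkD : ∀ (n : ℕ) (c : k), algebraMap k K c ∈ D n :=
    fun n c => mem_locPrime_of_mem _ _ _ ((tower O A (n + 1)).algebraMap_mem c)
  let algD : ∀ n : ℕ, Algebra k ↥(D n) := fun n => ((algebraMap k K).codRestrict (D n) (hkD n)).toAlgebra
  have hstD : ∀ n : ℕ, letI := algD n; IsScalarTower k ↥(D n) K := fun n => by
    letI := algD n
    exact IsScalarTower.of_algebraMap_eq fun _ => rfl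
  have hunit : ∀ (n : ℕ) (h : mₑ ≤ n + 1) (g : k[X]), g ≠ 0 →
      IsUnit (@Polynomial.aeval k ↥(D n) _ _ (algD n) (⟨s, hsD n h⟩ : ↥(D n)) g) := by
    intro n h g hg
    letI := algD n
    haveI := hstD n
    haveI := hP (n + 1)
    obtain ⟨hgT, hgP⟩ := aeval_escape_mem_not_mem O A hk hAO (n + 1) (P (n + 1)) (hsn n h) hvs (hsPn n h) g hg
    have hcoe : ((Polynomial.aeval (⟨s, hsD n h⟩ : ↥(D n)) g : ↥(D n)) : K) = Polynomial.aeval s g :=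
      (Polynomial.aeval_algHom_apply (IsScalarTower.toAlgHom k (↥(D n)) K) (⟨s, hsD n h⟩ : ↥(D n)) g).symm
    refine (isUnit_subring_iff_inv_mem _).mpr ⟨?_, ?_⟩
    · rw [hcoe]; exact ne_zero_of_not_mem_ideal _ _ hgT hgP
    · rw [hcoe]; exact inv_mem_locPrime_of_not_mem _ _ _ hgT hgP
  -- the union `D_∞`
  have hmono : Monotone D :=
    monotone_nat_of_le_succ fun n => (subringDominates_locPrime_tower_succ O A P hP hcompat (n + 1)).1
  let U : Subring K := ⨆ n, D n
  have hmemU : ∀ x : K, x ∈ U ↔ ∃ n, x ∈ D n := fun x => Subring.mem_iSup_of_directed hmono.directed_le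
  have hdomU : ∀ (n : ℕ) (x : K), x ∈ D n → x⁻¹ ∈ U → x⁻¹ ∈ D n := by
    intro n x hx hxU
    obtain ⟨m, hm⟩ := (hmemU _).mp hxU
    exact (subringDominates_locPrime_tower_of_le O A P hP hcompat
      (Nat.succ_le_succ (le_max_left n m))).2 x hx (hmono (le_max_right n m) hm)
  by_cases hval : ∀ t : K, t ∈ U ∨ t⁻¹ ∈ U
  · -- CASE A: the union is a valuation ring
    left
    let W : ValuationSubring K := { U with mem_or_inv_mem' := hval }
    have hWU : ∀ x : K, x ∈ W ↔ x ∈ U := fun _ => Iff.rfl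
    have hdomW : ∀ n : ℕ, SubringDominates (D n) W.toSubring := fun n =>
      ⟨fun x hx => (hWU x).mpr ((hmemU x).mpr ⟨n, hx⟩), fun x hx hxinv => hdomU n x hx ((hWU _).mp hxinv)⟩
    have hunionW : ∀ x : K, x ∈ W → ∃ n, x ∈ D n := fun x hx => (hmemU x).mp ((hWU x).mp hx)
    refine ⟨W, hdomW, hunionW, ⟨s, (hdomW mₑ).1 (hsD mₑ (Nat.le_succ _)), fun f hf => ?_⟩, ?_⟩
    · letI := algD mₑ
      haveI := hstD mₑ
      have h1 := valuation_eq_one_of_isUnit_subring W (D mₑ) (hdomW mₑ).1 _ (hunit mₑ (Nat.le_succ _) f hf)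
      have hcoe : ((Polynomial.aeval (⟨s, hsD mₑ (Nat.le_succ _)⟩ : ↥(D mₑ)) f : ↥(D mₑ)) : K) = Polynomial.aeval s f :=
        (Polynomial.aeval_algHom_apply (IsScalarTower.toAlgHom k (↥(D mₑ)) K) (⟨s, hsD mₑ (Nat.le_succ _)⟩ : ↥(D mₑ)) f).symm
      rw [hcoe] at h1
      exact h1
    · rintro ⟨B, hB, hBft⟩
      exact not_essFiniteType_of_dominated_union O A P hP hcompat W hdomW hunionW mₑ hsing B hB
  · -- CASE B: Abhyankar's Lemma 7 produces a prime divisor dominating the thread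
    right
    push Not at hval
    obtain ⟨t, htU, htU'⟩ := hval
    have htR : ∀ n, t ∉ D n := fun n h => htU ((hmemU t).mpr ⟨n, h⟩)
    have htR' : ∀ n, t⁻¹ ∉ D n := fun n h => htU' ((hmemU _).mpr ⟨n, h⟩)
    obtain ⟨V, htV, hVdom, hpoly⟩ :=
      exists_valuationSubring_dominates_of_chain' D (fun n => Parasite.isLocalRing_locPrime _ _ _)
        (fun n => subringDominates_locPrime_tower_succ O A P hP hcompat (n + 1))
        (fun n => isIntegrallyClosedIn_locPrime_tower O A hk hA hfr hAO P hP n) htR htR'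
    have hkV : ∀ c : k, algebraMap k K c ∈ V := fun c => (hVdom 0).1 (hkD 0 c)
    have hsV : s ∈ V := (hVdom mₑ).1 (hsD mₑ (Nat.le_succ _))
    have hyV : ∀ i, (![t, s] : Fin 2 → K) i ∈ V := by
      intro i; fin_cases i
      · exact htV
      · exact hsV
    have hval1 : ∀ f : MvPolynomial (Fin 2) k, f ≠ 0 → V.valuation (MvPolynomial.aeval ![t, s] f) = 1 := by
      letI := algD mₑ
      haveI := hstD mₑ
      exact valuation_mvPolynomial_aeval_eq_one V (D mₑ) (hVdom mₑ).1 htV (hpoly mₑ) ⟨s, hsD mₑ (Nat.le_succ _)⟩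
        (hunit mₑ (Nat.le_succ _))
    -- `V ≠ K`: a germ dominated by `K` is a field, but `D_(mₑ+1)` is singular
    have hVne : V ≠ ⊤ := by
      intro hVtop
      apply hsing mₑ le_rfl
      haveI : IsLocalRing ↥(D mₑ) := Parasite.isLocalRing_locPrime _ _ _
      have hfield : IsField ↥(D mₑ) := by
        rw [IsLocalRing.isField_iff_maximalIdeal_eq]
        rw [eq_bot_iff]
        intro x hx
        by_contra hx0
        have hx0' : (x : K) ≠ 0 := fun h => hx0 (by exact_mod_cast h)
        have hxinv : (x : K)⁻¹ ∈ D mₑ := (hVdom mₑ).2 x x.2 (hVtop ▸ ValuationSubring.mem_top _)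
        have hxu : IsUnit x := (isUnit_subring_iff_inv_mem x).mpr ⟨hx0', hxinv⟩
        exact (IsLocalRing.mem_maximalIdeal _).mp hx hxu
      exact isRegularLocalRing_of_isField hfield
    -- prime divisor ⇒ DVR
    have hDVR : IsDiscreteValuationRing ↥V := by
      letI := algebraOfMem k V hkV
      haveI := isScalarTower_algebraOfMem k V hkV
      haveI : Algebra.FiniteType k ↥A := A.fg_iff_finiteType.mp hA
      have hfg : (⊤ : IntermediateField k K).FG := IntermediateField.fg_top_of_isFractionRing_of_finiteType k ↥A K
      have hy := algebraicIndependent_residue_of_valuation V hkV ![t, s] hyV hval1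
      exact isDiscreteValuationRing_of_primeDivisor V hfg hVne (fun i => ⟨(![t, s] : Fin 2 → K) i, hyV i⟩) hy
        (by rw [htr]; norm_num)
    exact ⟨V, hkV, hDVR, ⟨![t, s], hyV, hval1⟩, hVdom⟩

end Main

/-! ## (GRD) Germ residue fields have transcendence degree `≤ 1`: residual dependence -/

section GRD

open Summit.ResolutionOfSingularities.ResolutionOfSingularities.Theorems.SwitchingDichotomy.LowTower
  (exists_trdeg_residueField_add_height_eq) in
/-- **(GRD) RESIDUAL DEPENDENCE IN THREAD GERMS** — the strategist's `Sig.GermResidueDep` binder for binder (proof ported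
from res-L0-w44-strat-1's `line-ndt-grd-r1.lean`).  Past the escape stage `mₑ` of an infinite singular prime thread in
transcendence degree `3`, any two elements `z 0, z 1` of the germ `D_(n+1) = (T_(n+1))_(P_(n+1))` (`n ≥ mₑ`) satisfy a
non-trivial polynomial relation over `k` MODULO the maximal ideal: some `f ≠ 0` in `k[X₀,X₁]` has `f(z)` equal to `0` or
a non-unit of the germ (`f(z)⁻¹ ∉ D_(n+1)`).  Proof: the escape element survives to stage `n + 1`, so T-GERM
(`Thread.threadGerm_of_trdeg`) gives `dim D_(n+1) = 2 = ht P_(n+1)` (`Thread.ringKrullDim_locPrime`); the dimension formula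
`tr.deg_k κ(D_(n+1)) + ht P_(n+1) = tr.deg_k K = 3` (`exists_trdeg_residueField_add_height_eq`, `T_(n+1)` essentially of
finite type over `k` with fraction field `K` by `tn_tower_invariant`) leaves `tr.deg_k κ = 1`, so the residues of
`z 0, z 1` are algebraically dependent (`AlgebraicIndependent.cardinalMk_le_trdeg`), i.e. some `f ≠ 0` has `f(z) ∈ 𝔪`.
[this work] -/
theorem germResidueDep (O : ValuationSubring K) (A : Subalgebra k K)
    (hk : ∀ c : k, algebraMap k K c ∈ O) (hA : A.FG) (hfr : IsFractionRing ↥A K)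
    (hAO : A.toSubring ≤ O.toSubring) (htr : Algebra.trdeg k K = 3)
    (P : ∀ m : ℕ, Ideal ↥(tower O A m)) (hP : ∀ m, (P m).IsPrime)
    (hcompat : ∀ (m : ℕ) (x : K) (hx : x ∈ tower O A m) (hx' : x ∈ tower O A (m + 1)),
      (⟨x, hx'⟩ : ↥(tower O A (m + 1))) ∈ P (m + 1) ↔ (⟨x, hx⟩ : ↥(tower O A m)) ∈ P m)
    (hca : ∀ (m : ℕ) (x : K) (hx : x ∈ tower O A m),
      x ∈ ca (tower O A m) → (⟨x, hx⟩ : ↥(tower O A m)) ∈ P m)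
    (mₑ : ℕ) (s : K) (hsT : s ∈ tower O A mₑ) (hvs : O.valuation s < 1)
    (hsP : (⟨s, hsT⟩ : ↥(tower O A mₑ)) ∉ P mₑ)
    (n : ℕ) (hn : mₑ ≤ n) (z : Fin 2 → K)
    (hz : ∀ i, z i ∈ locPrime (tower O A (n + 1)) (P (n + 1)) (hP (n + 1))) :
    ∃ f : MvPolynomial (Fin 2) k, f ≠ 0 ∧
      (MvPolynomial.aeval z f = 0 ∨
        (MvPolynomial.aeval z f)⁻¹ ∉ locPrime (tower O A (n + 1)) (P (n + 1)) (hP (n + 1))) := by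
  haveI := hfr
  haveI := hP (n + 1)
  -- the escaping element survives to stage `n + 1`, so T-GERM applies: `dim D = 2`
  have hsn : s ∈ tower O A (n + 1) := d2rc_mem_tower_of_le O A (hn.trans (Nat.le_succ n)) hsT
  have hsPn : (⟨s, hsn⟩ : ↥(tower O A (n + 1))) ∉ P (n + 1) :=
    Thread.not_mem_thread_of_le O A P hcompat hsT hsP (hn.trans (Nat.le_succ n)) hsn
  obtain ⟨hdim, -, -⟩ := Thread.threadGerm_of_trdeg O A hk hA hfr hAO htr n (P (n + 1)) (hP (n + 1))
    (hca (n + 1)) ⟨s, hsn, hvs, hsPn⟩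
  -- structure on the germ `Λ := D_(n+1)`
  set Λ : Subring K := locPrime (tower O A (n + 1)) (P (n + 1)) (hP (n + 1))
  letI : Algebra ↥(tower O A (n + 1)) ↥Λ :=
    (Subring.inclusion (Thread.toSubring_le_locPrime (tower O A (n + 1)) (P (n + 1)) (hP (n + 1)))).toAlgebra
  haveI := Thread.isLocalization_locPrime (tower O A (n + 1)) (P (n + 1)) (hP (n + 1))
  haveI : IsLocalRing ↥Λ := Parasite.isLocalRing_locPrime _ _ _
  letI : Algebra k ↥Λ :=
    ((algebraMap ↥(tower O A (n + 1)) ↥Λ).comp (algebraMap k ↥(tower O A (n + 1)))).toAlgebra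
  haveI : IsScalarTower k ↥(tower O A (n + 1)) ↥Λ := IsScalarTower.of_algebraMap_eq (fun _ => rfl)
  haveI : Algebra.EssFiniteType k ↥(tower O A (n + 1)) := (tn_tower_invariant O A hk hA hfr hAO (n + 1)).2.2
  haveI : IsFractionRing ↥(tower O A (n + 1)) K :=
    isFractionRing_subalgebra_of_le A _ (tn_tower_invariant O A hk hA hfr hAO (n + 1)).1
  -- the dimension formula at `P_(n+1)`
  obtain ⟨N, h, hN, hh, hsum⟩ :=
    exists_trdeg_residueField_add_height_eq (k := k) (F := K) (Λ := ↥Λ) (P (n + 1))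
  have hN3 : N = 3 := by
    rw [htr] at hN
    exact_mod_cast hN.symm
  have hh2 : h = 2 := by
    have e1 : ((P (n + 1)).height : WithBot ℕ∞) = 2 := by
      rw [← Thread.ringKrullDim_locPrime (tower O A (n + 1)) (P (n + 1)) (hP (n + 1))]
      exact hdim
    rw [hh] at e1
    have e2 : ((h : ℕ∞) : WithBot ℕ∞) = (((2 : ℕ) : ℕ∞) : WithBot ℕ∞) := by
      rw [e1]
      rfl
    exact ENat.coe_inj.mp (WithBot.coe_inj.mp e2)
  subst hN3 hh2
  -- residues of `z 0, z 1` are algebraically DEPENDENT over `k`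
  let zz : Fin 2 → ↥Λ := fun i => ⟨z i, hz i⟩
  let φ : ↥Λ →ₐ[k] ResidueField ↥Λ := IsScalarTower.toAlgHom k _ _
  have hdep : ¬ AlgebraicIndependent k (fun i => φ (zz i)) := by
    intro hind
    have h2 : Cardinal.mk (Fin 2) ≤ Algebra.trdeg k (ResidueField ↥Λ) := hind.cardinalMk_le_trdeg
    have h2' : (2 : Cardinal) ≤ Algebra.trdeg k (ResidueField ↥Λ) := by
      simpa using h2
    have hsum' : Algebra.trdeg k (ResidueField ↥Λ) + 2 = 3 := by
      exact_mod_cast hsum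
    have h4 : (2 : Cardinal) + 2 ≤ Algebra.trdeg k (ResidueField ↥Λ) + 2 := add_le_add h2' (le_refl _)
    rw [hsum'] at h4
    have h5 : (2 : ℕ) + 2 ≤ 3 := by exact_mod_cast h4
    omega
  rw [algebraicIndependent_iff] at hdep
  simp only [not_forall] at hdep
  obtain ⟨f, hf0, hfne⟩ := hdep
  refine ⟨f, hfne, ?_⟩
  -- `u := f(zz)` lies in the maximal ideal of the germ
  have hφu : φ (MvPolynomial.aeval zz f) = 0 := by
    rw [← hf0, ← MvPolynomial.comp_aeval]
    rfl
  have humax : MvPolynomial.aeval zz f ∈ maximalIdeal ↥Λ := by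
    rw [← IsLocalRing.residue_eq_zero_iff]
    exact hφu
  -- the value of `u` in `K` is `f(z)`
  let ψ : ↥Λ →ₐ[k] K := { Λ.subtype with commutes' := fun _ => rfl }
  have hval : ((MvPolynomial.aeval zz f : ↥Λ) : K) = MvPolynomial.aeval z f := by
    change ψ (MvPolynomial.aeval zz f) = _
    rw [← AlgHom.comp_apply, MvPolynomial.comp_aeval]
    rfl
  by_cases h0 : MvPolynomial.aeval z f = 0
  · exact Or.inl h0
  · refine Or.inr fun hinv => ?_
    have hunit : IsUnit (MvPolynomial.aeval zz f) := by
      refine isUnit_iff_exists_inv.mpr ⟨⟨(MvPolynomial.aeval z f)⁻¹, hinv⟩, ?_⟩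
      apply Subtype.ext
      change ((MvPolynomial.aeval zz f : ↥Λ) : K) * (MvPolynomial.aeval z f)⁻¹ = 1
      rw [hval, mul_inv_cancel₀ h0]
    exact (IsLocalRing.mem_maximalIdeal _).mp humax hunit

end GRD

end Summit.ResolutionOfSingularities.ResolutionOfSingularities.Theorems.NoZeno.Sandwiched

end
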